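import Literature.AlgebraicGeometry.AbelianSchemes.AbelianSchemeKOfLClosedSubscheme
import HarnessLib

/-!
# The scheme-theoretic seesaw for an abelian scheme over a Noetherian affine base (F-3 (Mc) node N1′ over `Spec R`)

Layer `Literature/AlgebraicGeometry/AbelianSchemes`, namespace `Literature.AlgebraicGeometry.AbelianSchemes.AbelianSchemeOver`.  THEOREMS
ONLY (no definition, no named fact, no instance, no notation, no `sorry`).  Cell `hodgecm-mathlib` (D-0151 / D-0183 FLOOR 0), programme P1,
sub-line F-3, child (M), grandchild node table (Mc) SPINE v0 (B-p02 (g16)), node **N1′** «the relative seesaw closed subscheme» in the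
`Spec R` base convention: the unconditional relative seesaw theorem ★ `Motives.SeesawRelative.exists_seesawSubscheme'` ([MumfordAV1970] §10
p. 89; [GortzWedhorn2023] Thm. 24.66; relative edition B-p08 (g11)) specialised to the projection `A ×_R W → W` of an ABELIAN SCHEME
`A → Spec R` (`R` Noetherian): its sockets are ★ — `A → Spec R` is proper, flat and universally open (smooth), geometrically integral
(★ `geometricallyIntegral_hom_overBase`) and universally Stein (★ `univStein_of_isNoetherianRing`).  This is the `W`-general companion of
★ `exists_isClosedImmersion_iff_memKOfL_of_isNoetherianRing` (same file of sockets, `W := A`, `𝓕 := Λ(L)`), and the token-for-token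
relative twin of ★ `Motives.AbelianVariety.stub_M13_1_seesawSubscheme_holds` (M13 node N1 over `ℂ`).  Count-neutral capital: HC_CM is
proved only modulo the 7 printed citations until rung 0 closes — nothing here bears on a summit statement.

* **`AbelianSchemeOver.exists_seesawSubscheme_of_isNoetherianRing`** — for `W → Spec R` locally of finite type and `𝓕` of rank one on
  `A ×_R W` there is a closed subscheme `Z ↪ W` such that an `R`-morphism `u : V → W` factors through `Z` iff `(1 × u)^*𝓕 ≅ pr_V^*𝓜` for
  some rank-one `𝓜` on `V`.

## References
* [MumfordAV1970] D. Mumford, *Abelian Varieties* (1970), §10 (p. 89).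
* [GortzWedhorn2023] U. Görtz, T. Wedhorn, *Algebraic Geometry II* (2023), Thm. 24.66 (p. 405; proof pp. 407–408), Cor. 24.63 (p. 404).
-/

noncomputable section

universe u

open CategoryTheory CategoryTheory.Limits AlgebraicGeometry MonoidalCategory CartesianMonoidalCategory
open scoped MonObj

namespace Literature.AlgebraicGeometry.AbelianSchemes

namespace AbelianSchemeOver

open Literature.AlgebraicGeometry.Motives Literature.AlgebraicGeometry.Modules

/-- **THE SCHEME-THEORETIC SEESAW FOR AN ABELIAN SCHEME OVER A NOETHERIAN AFFINE BASE** ([GortzWedhorn2023] Thm. 24.66 for the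
projection `A ×_R W → W`; [MumfordAV1970] §10): for `A → Spec R` an abelian scheme (`R` Noetherian), `W → Spec R` locally of finite
type and `𝓕` of rank one on `A ×_R W`, there is a closed subscheme `Z ↪ W` such that an `R`-morphism `u : V → W` factors through `Z`
iff `(1_A × u)^*𝓕 ≅ pr_V^*𝓜` for some rank-one `𝓜` on `V` — ★ `SeesawRelative.exists_seesawSubscheme'` with its sockets discharged
(proper, smooth ⇒ flat + universally open, ★ `geometricallyIntegral_hom_overBase`, ★ `univStein_of_isNoetherianRing`).
[cite: GortzWedhorn2023, Thm. 24.66 (p. 405; proof pp. 407–408)] [cite: MumfordAV1970, §10 (p. 89)] -/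
theorem exists_seesawSubscheme_of_isNoetherianRing {R : Type} [CommRing R] [IsNoetherianRing R]
    (A : AbelianSchemeOver (Spec (.of R))) (W : Over (Spec (.of R))) [LocallyOfFiniteType W.hom]
    (𝓕 : (A.X ⊗ W).left.Modules) (h𝓕 : HasRank 𝓕 1) :
    ∃ (Z : Over (Spec (.of R))) (i : Z ⟶ W) (_ : IsClosedImmersion i.left),
      ∀ (V : Over (Spec (.of R))) (u : V ⟶ W),
        (∃ v : V ⟶ Z, v ≫ i = u) ↔
          ∃ (𝓜 : V.left.Modules) (_ : HasRank 𝓜 1),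
            Nonempty ((Scheme.Modules.pullback (A.X ◁ u).left).obj 𝓕 ≅
              (Scheme.Modules.pullback (CartesianMonoidalCategory.snd A.X V).left).obj 𝓜) := by
  haveI : IsProper A.X.hom := A.isProper
  haveI : Smooth A.X.hom := A.isSmooth
  haveI : GeometricallyIntegral A.X.hom := A.geometricallyIntegral_hom_overBase
  haveI : Flat A.X.hom := inferInstance
  haveI : LocallyOfFinitePresentation A.X.hom := inferInstance
  haveI : UniversallyOpen A.X.hom := inferInstance
  exact SeesawRelative.exists_seesawSubscheme' A.X A.univStein_of_isNoetherianRing W 𝓕 h𝓕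

end AbelianSchemeOver

end Literature.AlgebraicGeometry.AbelianSchemes

end
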